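import Literature.NumberTheory.Rogawski1990.ArchBouazizStableFamily     -- ★ p849717 (LH3-p01 (g3)): `stOrbFamH`, `archBzPeriodic_stOrbFamH`; brings ★ `ArchBzSmoothBounded`, `ArchBzPeriodic`, `InRegS`, `angleShift`
import HarnessLib

/-!
# Clause (I₁)+(I₂) of Bouaziz's space reduces to the FUNDAMENTAL SLAB `0 < θ_{w,0} − θ_{w,2} < 2π` under periodicity (P)
# ((SB-H) reduction; Bouaziz 1994 §3.1, Shelstad 1979 §4)

Topic `NumberTheory/Rogawski1990`; namespace `Literature.NumberTheory.Rogawski1990`.  THEOREMS ONLY.  Cell `pub/hodgecm-mathlib`, line LH3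
(closer stub `stub_N9`, crux H413 = `stmt-HodgeConjecture-24833`), organ O-L3′ clause (SB) = ★ `ArchBzSmoothBounded` (`ArchBouazizSpaceH.lean` :117)
for the stable orbital family ★ `stOrbFamH` (LH3-plan (g3) DEALER BOARD #1 (iii), 2026-09-02); count-neutral.

THE MATHEMATICS.  ★ `ArchBzSmoothBounded Ψ` asks, for every chart `S`: [C1] `Ψ S` is `C^∞` on `InRegS S` and [C2] every derivative is bounded on
`K ∩ InRegS S` for compact `K`.  The in-regular set `InRegS S` removes only the COMPACT walls `θ_{w,0} ≡ θ_{w,2} (mod 2π)`, `w ∉ S`; in the real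
coordinates it is the disjoint, locally finite union of the open SLABS `slab_k = {2πk_w < c w 0 − c w 2 < 2π(k_w+1), w ∉ S}`, `k : W → ℤ` (§1), and the
`2π`-shift `c ↦ c + Σ_{w∉S} angleShift w 0 (k w)` carries `slab_0` onto `slab_k` (§2).  For a family periodic in the angle slots (★ `ArchBzPeriodic`,
clause (P)) `Ψ S` is invariant under these shifts (§3), and `iteratedFDeriv` commutes with translations (Mathlib `iteratedFDeriv_comp_add_right`), so BOTH
clauses reduce to the fundamental slab `slab_0 = {0 < c w 0 − c w 2 < 2π, w ∉ S}` (§4, HEAD `archBzSmoothBounded_of_periodic_of_slab_zero`): [C1] on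
`slab_0` and [C2] on `K ∩ slab_0` for all compact `K` suffice.  For `Ψ = stOrbFamH L νH fH` (P) is ★ `archBzPeriodic_stOrbFamH`, so (SB-H) = the two
slab-zero statements (§5) — [C1] there = ★ (I₃-RegS-H) `contDiffOn_stOrbFamH_regS` on the regular germ + Harish-Chandra's smoothness across the split
walls `x_w = 0`, [C2] there = the bounded one-sided jets at the two faces `θ_{w,0} − θ_{w,2} ∈ {0, 2π}` (Bouaziz (I₂)); neither is claimed here.
HONEST LABEL: bookkeeping only; HC_CM is proved only modulo the 7 printed citations (2 remaining: hLiu418 = stmt-HodgeConjecture-24832, h413 =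
stmt-HodgeConjecture-24833) until rung 0 closes.

## References
* [Bouaziz1994IntegralesOrbitales] A. Bouaziz, *Intégrales orbitales sur les algèbres de Lie réductives*, Invent. Math. 115 (1994), §3.1 p. 579 ((I₁), (I₂)), §6.2 p. 591.
* [Shelstad1979] D. Shelstad, *Characters and inner forms of a quasi-split group over ℝ*, Compositio Math. 39 (1979), §4 pp. 22–23.
-/

set_option autoImplicit false

noncomputable section

open Set Function Real Finset MeasureTheory NumberField NumberField.InfinitePlace
open Literature.NumberTheory.Automorphic Literature.NumberTheory.Automorphic.ArchCartan Literature.NumberTheory.Automorphic.UnitaryGroup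
open scoped ContDiff Classical

namespace Literature.NumberTheory.Rogawski1990

section Slab

variable {W : Type*} [Fintype W] [DecidableEq W]

/-! ## §1 The slabs of `InRegS S` -/

omit [Fintype W] [DecidableEq W] in
/-- **A slab point is in-regular**: `2πk_w < c w 0 − c w 2 < 2π(k_w + 1)` for all `w ∉ S` forces `e^{i c_w0} ≠ e^{i c_w2}`.
[cite: Bouaziz1994IntegralesOrbitales, §3.1 p. 579] -/
theorem mem_inRegS_of_mem_slab (S : Finset W) (k : W → ℤ) {c : W → Fin 3 → ℝ}
    (hc : ∀ w, w ∉ S → 2 * π * k w < c w 0 - c w 2 ∧ c w 0 - c w 2 < 2 * π * (k w + 1)) : c ∈ InRegS S := by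
  intro w hw
  rw [circleExp_ne_iff_forall_int]
  intro m hm
  obtain ⟨h1, h2⟩ := hc w hw
  rw [hm] at h1 h2
  have h1' : (k w : ℝ) < m := lt_of_mul_lt_mul_left h1 Real.two_pi_pos.le
  have h2' : (m : ℝ) < k w + 1 := lt_of_mul_lt_mul_left h2 Real.two_pi_pos.le
  have h3 : k w < m := by exact_mod_cast h1'
  have h4 : m < k w + 1 := by exact_mod_cast h2'
  omega

omit [Fintype W] in
/-- **Every in-regular point lies in a slab**, namely `k_w = ⌊(c w 0 − c w 2)∕2π⌋` at `w ∉ S` (and `k_w = 0` on `S`).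
[cite: Bouaziz1994IntegralesOrbitales, §3.1 p. 579] -/
theorem exists_slab_of_mem_inRegS (S : Finset W) {c : W → Fin 3 → ℝ} (hc : c ∈ InRegS S) :
    ∃ k : W → ℤ, (∀ w, w ∈ S → k w = 0) ∧
      ∀ w, w ∉ S → 2 * π * k w < c w 0 - c w 2 ∧ c w 0 - c w 2 < 2 * π * (k w + 1) := by
  refine ⟨fun w => if w ∈ S then 0 else ⌊(c w 0 - c w 2) / (2 * π)⌋, fun w hw => by simp [hw], fun w hw => ?_⟩
  simp only [hw, if_false]
  have hfl := Int.floor_le ((c w 0 - c w 2) / (2 * π))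
  have hlt := Int.lt_floor_add_one ((c w 0 - c w 2) / (2 * π))
  have hne : c w 0 - c w 2 ≠ 2 * π * ⌊(c w 0 - c w 2) / (2 * π)⌋ := (circleExp_ne_iff_forall_int _ _).1 (hc w hw) _
  have hid : 2 * π * ((c w 0 - c w 2) / (2 * π)) = c w 0 - c w 2 := by field_simp
  constructor
  · have hle : 2 * π * (⌊(c w 0 - c w 2) / (2 * π)⌋ : ℝ) ≤ c w 0 - c w 2 := by
      have := mul_le_mul_of_nonneg_left hfl Real.two_pi_pos.le
      rwa [hid] at this
    exact lt_of_le_of_ne hle (Ne.symm hne)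
  · have := mul_lt_mul_of_pos_left hlt Real.two_pi_pos
    rw [hid] at this
    exact this

omit [DecidableEq W] in
/-- **The slabs are open.** [cite: Bouaziz1994IntegralesOrbitales, §3.1 p. 579] -/
theorem isOpen_slab (S : Finset W) (k : W → ℤ) :
    IsOpen {c : W → Fin 3 → ℝ | ∀ w, w ∉ S → 2 * π * k w < c w 0 - c w 2 ∧ c w 0 - c w 2 < 2 * π * (k w + 1)} := by
  have h : {c : W → Fin 3 → ℝ | ∀ w, w ∉ S → 2 * π * k w < c w 0 - c w 2 ∧ c w 0 - c w 2 < 2 * π * (k w + 1)} =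
      ⋂ w ∈ ((↑S : Set W)ᶜ), ((fun c : W → Fin 3 → ℝ => c w 0 - c w 2) ⁻¹' Ioo (2 * π * k w) (2 * π * (k w + 1))) := by
    ext c
    simp only [mem_setOf_eq, mem_iInter, mem_compl_iff, Finset.mem_coe, Set.mem_preimage, Set.mem_Ioo]
  rw [h]
  refine (Set.toFinite _).isOpen_biInter fun w _ => ?_
  have h0 : Continuous (fun c : W → Fin 3 → ℝ => c w 0) := (continuous_apply 0).comp (continuous_apply w)
  have h2 : Continuous (fun c : W → Fin 3 → ℝ => c w 2) := (continuous_apply 2).comp (continuous_apply w)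
  have hc : Continuous (fun c : W → Fin 3 → ℝ => c w 0 - c w 2) := h0.sub h2
  exact hc.isOpen_preimage _ isOpen_Ioo

/-! ## §2 The `2π`-shifts between the slabs -/

/-- The shift `Σ_{w ∉ S} angleShift w 0 (k w)` read in coordinates: it adds `2π k_w` to the slot `0` at the places `w ∉ S` and nothing else.
[cite: Shelstad1979, §4 p. 22] -/
theorem sum_angleShift_apply (S : Finset W) (k : W → ℤ) (w : W) (i : Fin 3) :
    (∑ w' ∈ Sᶜ, angleShift w' 0 (k w') : W → Fin 3 → ℝ) w i = if w ∉ S ∧ i = 0 then 2 * π * k w else 0 := by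
  rw [Finset.sum_apply, Finset.sum_apply]
  simp only [angleShift]
  by_cases hw : w ∈ S
  · rw [Finset.sum_eq_zero fun w' hw' => ?_]
    · simp [hw]
    · have hne : w ≠ w' := fun h => (Finset.mem_compl.1 hw') (h ▸ hw)
      rw [Pi.single_eq_of_ne hne, Pi.zero_apply]
  · rw [Finset.sum_eq_single_of_mem w (Finset.mem_compl.2 hw) fun w' _ hne => by rw [Pi.single_eq_of_ne hne.symm, Pi.zero_apply]]
    rw [Pi.single_eq_same]
    by_cases hi : i = 0
    · subst hi; simp [hw]
    · rw [Pi.single_eq_of_ne hi]; simp [hi]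

/-- **The shift by `k` carries `slab_m` onto `slab_{m+k}`.** [cite: Shelstad1979, §4 p. 22] -/
theorem add_sum_angleShift_mem_slab_iff (S : Finset W) (k m : W → ℤ) (c : W → Fin 3 → ℝ) :
    (∀ w, w ∉ S → 2 * π * ((m w + k w : ℤ) : ℝ) < (c + ∑ w' ∈ Sᶜ, angleShift w' 0 (k w')) w 0 - (c + ∑ w' ∈ Sᶜ, angleShift w' 0 (k w')) w 2 ∧
        (c + ∑ w' ∈ Sᶜ, angleShift w' 0 (k w')) w 0 - (c + ∑ w' ∈ Sᶜ, angleShift w' 0 (k w')) w 2 < 2 * π * (((m w + k w : ℤ) : ℝ) + 1)) ↔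
      ∀ w, w ∉ S → 2 * π * m w < c w 0 - c w 2 ∧ c w 0 - c w 2 < 2 * π * (m w + 1) := by
  refine forall_congr' fun w => forall_congr' fun hw => ?_
  simp only [Pi.add_apply, sum_angleShift_apply, hw, not_false_eq_true, true_and, if_true, show (2 : Fin 3) ≠ 0 by decide,
    if_false, add_zero]
  push_cast
  constructor <;> rintro ⟨h1, h2⟩ <;> constructor <;> linarith

/-! ## §3 Periodic families are invariant under the shifts -/

/-- **(P) ⇒ invariance under `Σ_{w ∉ S} angleShift w 0 (k w)`.** [cite: Shelstad1979, §4 p. 22] [cite: Bouaziz1994IntegralesOrbitales, §3.1 p. 579] -/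
theorem apply_add_sum_angleShift_of_periodic {Ψ : Finset W → (W → Fin 3 → ℝ) → ℂ} (hP : ArchBzPeriodic Ψ) (S : Finset W) (k : W → ℤ)
    (c : W → Fin 3 → ℝ) : Ψ S (c + ∑ w ∈ Sᶜ, angleShift w 0 (k w)) = Ψ S c := by
  suffices h : ∀ s : Finset W, s ⊆ Sᶜ → ∀ c : W → Fin 3 → ℝ, Ψ S (c + ∑ w ∈ s, angleShift w 0 (k w)) = Ψ S c from
    h _ Finset.Subset.rfl c
  intro s
  induction s using Finset.induction_on with
  | empty => intro _ c; rw [Finset.sum_empty, add_zero]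
  | insert a s ha ih =>
    intro hs c
    rw [Finset.sum_insert ha, ← add_assoc, add_right_comm,
      hP S _ a 0 (k a) (Or.inl (Finset.mem_compl.1 (hs (Finset.mem_insert_self a s))))]
    exact ih (fun x hx => hs (Finset.mem_insert_of_mem hx)) c

/-- … hence `Ψ S` equals its own translate by the shift, as a function. [cite: Shelstad1979, §4 p. 22] -/
theorem eq_comp_add_sum_angleShift_of_periodic {Ψ : Finset W → (W → Fin 3 → ℝ) → ℂ} (hP : ArchBzPeriodic Ψ) (S : Finset W) (k : W → ℤ) :
    Ψ S = fun c => Ψ S (c + ∑ w ∈ Sᶜ, angleShift w 0 (k w)) :=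
  funext fun c => (apply_add_sum_angleShift_of_periodic hP S k c).symm

/-! ## §4 The reduction to the fundamental slab -/

/-- The sup norm of the shift is at most `B` as soon as `2π|k_w| ≤ B` at every `w ∉ S`. [cite: Shelstad1979, §4 p. 22] -/
theorem norm_sum_angleShift_le (S : Finset W) (k : W → ℤ) (B : ℝ) (hB : ∀ w, w ∉ S → 2 * π * |(k w : ℝ)| ≤ B) (hB0 : 0 ≤ B) :
    ‖(∑ w' ∈ Sᶜ, angleShift w' 0 (k w') : W → Fin 3 → ℝ)‖ ≤ B := by
  refine (pi_norm_le_iff_of_nonneg hB0).2 fun w => (pi_norm_le_iff_of_nonneg hB0).2 fun i => ?_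
  rw [sum_angleShift_apply, Real.norm_eq_abs]
  split_ifs with h
  · rw [abs_mul, abs_of_pos Real.two_pi_pos]
    exact hB w h.1
  · rw [abs_zero]; exact hB0

/-- **REDUCTION OF (I₁)+(I₂) TO THE FUNDAMENTAL SLAB.**  For a family `Ψ` periodic in the angle slots (★ `ArchBzPeriodic`), smoothness on the
fundamental slab `slab_0 = {0 < c w 0 − c w 2 < 2π, w ∉ S}` of every chart and boundedness of every derivative on `K ∩ slab_0` for all compact `K`
imply ★ `ArchBzSmoothBounded Ψ` (both clauses on all of `InRegS S = ⋃_k slab_k`, through the `2π`-shifts, `iteratedFDeriv` commuting with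
translations). [cite: Bouaziz1994IntegralesOrbitales, §3.1 p. 579] [cite: Shelstad1979, §4 p. 22] -/
theorem archBzSmoothBounded_of_periodic_of_slab_zero {Ψ : Finset W → (W → Fin 3 → ℝ) → ℂ} (hP : ArchBzPeriodic Ψ)
    (h1 : ∀ S : Finset W, ContDiffOn ℝ ∞ (Ψ S) {c | ∀ w, w ∉ S → 0 < c w 0 - c w 2 ∧ c w 0 - c w 2 < 2 * π})
    (h2 : ∀ (S : Finset W) (n : ℕ) (K : Set (W → Fin 3 → ℝ)), IsCompact K →
      BddAbove ((fun c => ‖iteratedFDeriv ℝ n (Ψ S) c‖) '' (K ∩ {c | ∀ w, w ∉ S → 0 < c w 0 - c w 2 ∧ c w 0 - c w 2 < 2 * π}))) :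
    ArchBzSmoothBounded Ψ := by
  intro S
  -- the shift by `-k` carries `slab_k` into `slab_0`
  have hshift : ∀ (k : W → ℤ) (c : W → Fin 3 → ℝ),
      (∀ w, w ∉ S → 2 * π * k w < c w 0 - c w 2 ∧ c w 0 - c w 2 < 2 * π * (k w + 1)) →
        (c + ∑ w' ∈ Sᶜ, angleShift w' 0 (-k w')) ∈ {c : W → Fin 3 → ℝ | ∀ w, w ∉ S → 0 < c w 0 - c w 2 ∧ c w 0 - c w 2 < 2 * π} := by
    intro k c hc w hw
    have h := (add_sum_angleShift_mem_slab_iff S (fun w => -k w) k c).2 hc w hw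
    simp only [add_neg_cancel, Int.cast_zero, mul_zero, zero_add, mul_one] at h
    exact h
  -- [C1] on each slab, through the shift
  have hC1k : ∀ k : W → ℤ,
      ContDiffOn ℝ ∞ (Ψ S) {c | ∀ w, w ∉ S → 2 * π * k w < c w 0 - c w 2 ∧ c w 0 - c w 2 < 2 * π * (k w + 1)} := by
    intro k
    rw [eq_comp_add_sum_angleShift_of_periodic hP S (fun w => -k w)]
    exact (h1 S).comp (contDiff_id.add contDiff_const).contDiffOn fun c hc => hshift k c hc
  refine ⟨fun c hc => ?_, fun n K hK => ?_⟩
  · obtain ⟨k, -, hk⟩ := exists_slab_of_mem_inRegS S hc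
    exact ((hC1k k).contDiffAt ((isOpen_slab S k).mem_nhds hk)).contDiffWithinAt
  · -- [C2]: all of `K ∩ InRegS S` is shifted into `K' ∩ slab_0` for ONE compact `K' = closedBall 0 (3R + 2π)`
    obtain ⟨R₀, hR₀⟩ := hK.isBounded.exists_norm_le
    have hR : ∀ x ∈ K, ‖x‖ ≤ max R₀ 0 := fun x hx => (hR₀ x hx).trans (le_max_left _ _)
    have hR0 : 0 ≤ max R₀ 0 := le_max_right _ _
    obtain ⟨M, hM⟩ := h2 S n _ (isCompact_closedBall (0 : W → Fin 3 → ℝ) (3 * max R₀ 0 + 2 * π))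
    refine ⟨M, ?_⟩
    rintro _ ⟨c, ⟨hcK, hcI⟩, rfl⟩
    obtain ⟨k, -, hk⟩ := exists_slab_of_mem_inRegS S hcI
    have hD : iteratedFDeriv ℝ n (Ψ S) c = iteratedFDeriv ℝ n (Ψ S) (c + ∑ w' ∈ Sᶜ, angleShift w' 0 (-k w')) := by
      conv_lhs => rw [eq_comp_add_sum_angleShift_of_periodic hP S (fun w => -k w)]
      exact iteratedFDeriv_comp_add_right n _ c
    show ‖iteratedFDeriv ℝ n (Ψ S) c‖ ≤ M
    rw [hD]
    refine hM ⟨c + ∑ w' ∈ Sᶜ, angleShift w' 0 (-k w'), ⟨?_, hshift k c hk⟩, rfl⟩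
    rw [Metric.mem_closedBall, dist_zero_right]
    refine (norm_add_le _ _).trans ?_
    have hsh : ‖(∑ w' ∈ Sᶜ, angleShift w' 0 (-k w') : W → Fin 3 → ℝ)‖ ≤ 2 * max R₀ 0 + 2 * π := by
      refine norm_sum_angleShift_le S (fun w => -k w) (2 * max R₀ 0 + 2 * π) (fun w hw => ?_) (by positivity)
      obtain ⟨hlo, hhi⟩ := hk w hw
      have hc0 : |c w 0| ≤ max R₀ 0 := by
        have := (norm_le_pi_norm (c w) 0).trans ((norm_le_pi_norm c w).trans (hR c hcK))
        rwa [Real.norm_eq_abs] at this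
      have hc2 : |c w 2| ≤ max R₀ 0 := by
        have := (norm_le_pi_norm (c w) 2).trans ((norm_le_pi_norm c w).trans (hR c hcK))
        rwa [Real.norm_eq_abs] at this
      have hkabs : 2 * π * |((-k w : ℤ) : ℝ)| ≤ |c w 0 - c w 2| + 2 * π := by
        push_cast
        rw [abs_neg]
        rcases le_or_gt 0 (k w : ℝ) with hk0 | hk0
        · rw [abs_of_nonneg hk0]; linarith [le_abs_self (c w 0 - c w 2)]
        · rw [abs_of_neg hk0]; linarith [neg_abs_le (c w 0 - c w 2)]
      linarith [abs_sub (c w 0) (c w 2)]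
    linarith [hR c hcK]

end Slab

/-! ## §5 The stable orbital family: (SB-H) = the two slab-zero statements -/

section Family

variable (L : Type) [Field L] [NumberField L] [IsCMField L]
  [MeasurableSpace (↥(arch (↥(maximalRealSubfield L)) L (IsCMField.complexConj L) 2 (Matrix.of fun i j : Fin 2 => if i.val + j.val + 1 = 2 then (1 : L) else 0)) ×
      ↥(arch (↥(maximalRealSubfield L)) L (IsCMField.complexConj L) 1 (Matrix.of fun i j : Fin 1 => if i.val + j.val + 1 = 1 then (1 : L) else 0)))]
  [BorelSpace (↥(arch (↥(maximalRealSubfield L)) L (IsCMField.complexConj L) 2 (Matrix.of fun i j : Fin 2 => if i.val + j.val + 1 = 2 then (1 : L) else 0)) ×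
      ↥(arch (↥(maximalRealSubfield L)) L (IsCMField.complexConj L) 1 (Matrix.of fun i j : Fin 1 => if i.val + j.val + 1 = 1 then (1 : L) else 0)))]
  (νH : MeasureTheory.Measure (↥(arch (↥(maximalRealSubfield L)) L (IsCMField.complexConj L) 2 (Matrix.of fun i j : Fin 2 => if i.val + j.val + 1 = 2 then (1 : L) else 0)) ×
      ↥(arch (↥(maximalRealSubfield L)) L (IsCMField.complexConj L) 1 (Matrix.of fun i j : Fin 1 => if i.val + j.val + 1 = 1 then (1 : L) else 0))))
  [MeasureTheory.IsFiniteMeasureOnCompacts νH] [νH.IsMulRightInvariant]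

/-- **(SB-H) REDUCED**: for the normalised stable orbital family ★ `stOrbFamH` ((P) is ★ `archBzPeriodic_stOrbFamH`), clause (I₁)+(I₂) of Bouaziz's
space follows from its two slab-zero statements — smoothness on `{0 < θ_{w,0} − θ_{w,2} < 2π, w ∉ S}` (the regular germ is ★ `contDiffOn_stOrbFamH_regS`;
what remains is Harish-Chandra's smoothness across the split walls `x_w = 0`) and bounded jets at its two faces (Bouaziz (I₂)).
[cite: Bouaziz1994IntegralesOrbitales, §3.1 p. 579; §6.2 p. 591] [cite: Shelstad1979, §4 pp. 22–23] -/
theorem archBzSmoothBounded_stOrbFamH_of_slab_zero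
    (fH : ↥(arch (↥(maximalRealSubfield L)) L (IsCMField.complexConj L) 2 (Matrix.of fun i j : Fin 2 => if i.val + j.val + 1 = 2 then (1 : L) else 0)) ×
      ↥(arch (↥(maximalRealSubfield L)) L (IsCMField.complexConj L) 1 (Matrix.of fun i j : Fin 1 => if i.val + j.val + 1 = 1 then (1 : L) else 0)) → ℂ)
    (h1 : ∀ S : Finset {w : NumberField.InfinitePlace L // w.IsComplex},
      ContDiffOn ℝ ∞ (stOrbFamH L νH fH S) {c | ∀ w, w ∉ S → 0 < c w 0 - c w 2 ∧ c w 0 - c w 2 < 2 * π})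
    (h2 : ∀ (S : Finset {w : NumberField.InfinitePlace L // w.IsComplex}) (n : ℕ) (K : Set ({w : NumberField.InfinitePlace L // w.IsComplex} → Fin 3 → ℝ)),
      IsCompact K → BddAbove ((fun c => ‖iteratedFDeriv ℝ n (stOrbFamH L νH fH S) c‖) '' (K ∩ {c | ∀ w, w ∉ S → 0 < c w 0 - c w 2 ∧ c w 0 - c w 2 < 2 * π}))) :
    ArchBzSmoothBounded (stOrbFamH L νH fH) :=
  archBzSmoothBounded_of_periodic_of_slab_zero (archBzPeriodic_stOrbFamH L νH fH) h1 h2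

end Family

end Literature.NumberTheory.Rogawski1990

end
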